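import Mathlib
import HarnessLib
import Summits.NavierStokesRegularity.NavierStokesRegularity.Theorems.SubOnsagerCeilingKPChainPeak

/-!
# Where the first weighted overshoot of the Katz–Pavlović chain can happen: the front dichotomy
# (helper file for the crux `SubOnsagerCeiling.ForwardTailCeilingKP`, stmt-NavierStokesRegularity-27057, `--supports`)

Chain format VERBATIM that of `Theorems/SubOnsagerCeilingKPChainPeak.lean` (hand leafhand-4-g0) and of the LEAD's chain
rungs: an honest solution `Z_k : [0,s] → ℝ` (`k ≥ -1`, `Z_{-1} ≡ 0`) of the NS-scaled viscous chain
`Ż_k = c₀ (b^{5(k-1)/2} Z_{k-1}² − b^{5k/2} Z_k Z_{k+1}) − ν b^{2k} Z_k` from the one-shell datum `Z_k(0) = x₀ 1_{k=0}`,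
continuous on `[0,s]`, non-negative on the shells `k ≥ 1`.  Write `V_k := (b^θ)^k Z_k` for the `θ`-weighted amplitudes;
the `θ`-shell barrier of the registered stubs `stub_primaryGradedSmallRatio` / `stub_primaryGradedLargeRatio` (restricted to
the one-mode chain) is `V_k(t)² ≤ D x₀²` for all `k, t`, uniformly in `ν`.

* `peak_product_le` — at a peak time `t⋆` of the shell `k ≥ 1` on `[0,s]`: `b^{5/2} Z_k(t⋆) Z_{k+1}(t⋆) ≤ Z_{k-1}(t⋆)²`
  (one-sided Fermat = `KPChainPeak.peak_ineq`, the dissipation dropped);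
* `weighted_peak_product_le` — the same in the weighted currency, for EVERY exponent `θ`:
  `V_k(t⋆) · V_{k+1}(t⋆) ≤ b^{3θ − 5/2} · V_{k-1}(t⋆)²`; at the Kolmogorov exponent `θ = 5/6` the factor is `1`
  (`weighted_peak_product_le_kolmogorov`), and it is `≤ 1` for `θ ≤ 5/6`, `b ≥ 1`;
* **`barrier_or_firstOvershoot`** — THE FRONT DICHOTOMY (every `b > 0`, `θ`, `D ≥ 1`, `ν ≥ 0`, every window): EITHER the
  `(θ, D)` barrier `V_k(t)² ≤ D x₀²` holds for every shell and every `t ∈ [0,s]`, OR there are a FIRST offending shell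
  `k ≥ 1` and a peak time `t⋆ ∈ (0, s]` of it such that (i) `V_k(t⋆)² > D x₀²` while `V_j(τ)² ≤ D x₀²` for all `j < k`,
  `τ ∈ [0,s]`; (ii) the feed dominates drain plus dissipation at `t⋆` (peak inequality); (iii) the weighted profile at `t⋆` is a
  STRICT LOCAL MAXIMUM AT `k` WHOSE FORWARD NEIGHBOUR LIES BELOW THE BACKWARD ONE by the factor `b^{3θ−5/2}`:
  `V_{k+1}(t⋆) ≤ b^{3θ−5/2} |V_{k-1}(t⋆)| < b^{3θ-5/2} V_k(t⋆)`.
  So a first overshoot never happens inside a weighted-increasing stretch of the profile (the rarefaction / Kolmogorov wake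
  behind the front): it happens at the LEADING EDGE, where the profile drops ahead of the peak shell;
* `barrier_of_noFrontOvershoot` — contrapositive packaging: if no shell `k ≥ 1` has a peak time in `(0,s]` with the front
  configuration (i)–(iii), the `(θ, D)` barrier holds on `[0,s]`.

Use (memo FRONT-TRANSPORT-leafhand4-g9.md on the item).  In the Kolmogorov-weighted currency `u_k = (b^{5/6})^k Z_k` the
inviscid chain reads `u̇_k = c₀ b^{-5/6} (b^{5/3})^k (u_{k-1}² − u_k u_{k+1})`: constants are equilibria at every ratio, the
energy `Σ_k b^{-5k/3} u_k²/2` is conserved, and as `b ↓ 1` the smooth part of the dynamics is the transport equation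
`w_T + (3A/2) e^{5κ/3} w^{1/2} w_κ = 0` for `w = u²/2` (a conservation law `E_T + ∂_κ(A e^{5κ/2} E^{3/2}) = 0` in the shell
energy), whose entropy solutions obey the maximum principle `sup_κ w(T) ≤ sup_κ w(0)` — the `θ = 5/6`, `D = 1` barrier that
hands 4-g2 / 4-g8 measure for `b ≤ 1.03`.  The dichotomy above is the lattice form of «the maximum principle can only fail
at the shock»: the analytic small-ratio theorem (repair census item (A′) of hand 4-g8) is EXACTLY a no-overshoot lemma for
the discrete front (entropy shock of the `E`-conservation law, speed `2 c₀ b^{-5/6}(b^{5/3})^k u_-` = twice the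
characteristic-free Rankine–Hugoniot speed of the `u`-equation), nothing about the wake.
HONEST FRAMING: statements about a MODEL lattice ODE (route SubOnsagerCeiling, rung TL-M2Break); no stub, crux or summit
is proved here and nothing in this file bears on Navier–Stokes regularity.
[cite: BarbatoMorandinRomito2011, §2 Lemma 2.1 (the face `Y_n = 1` is the static peak inequality)]
[cite: Tao2016AveragedNS, §4 (4.13)]
-/

noncomputable section

-- the sub-problem namespace `NavierStokesRegularity.NavierStokesRegularity` is the tree's layout (D-0017)
set_option linter.dupNamespace false

namespace Summit.NavierStokesRegularity.NavierStokesRegularity.Theorems.KPChainFront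

open Set
open Summit.NavierStokesRegularity.NavierStokesRegularity.Theorems.KPChainPeak

/-- **Peak product inequality.** At a peak time `t⋆ ∈ [0,s]` of the shell `k ≥ 1` of the non-negative viscous chain
(`c₀ > 0`, `ν ≥ 0`): `b^{5/2} Z_k(t⋆) Z_{k+1}(t⋆) ≤ Z_{k-1}(t⋆)²` (the dissipation `ν b^{2k} Z_k(t⋆) ≥ 0` is dropped from
`KPChainPeak.peak_ineq` and the common factor `c₀ b^{5(k-1)/2}` cancelled).
[cite: BarbatoMorandinRomito2011, §2 Lemma 2.1] -/
theorem peak_product_le {b c₀ ν s x₀ : ℝ} (hb : 0 < b) (hc₀ : 0 < c₀) (hν : 0 ≤ ν)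
    {Z : ℤ → ℝ → ℝ}
    (hdat : ∀ k : ℤ, Z k 0 = if k = 0 then x₀ else 0)
    (hode : ∀ k : ℕ, ∀ t ∈ Icc 0 s, HasDerivWithinAt (Z k)
      (c₀ * (b ^ ((5 : ℝ) * ((k : ℝ) - 1) / 2) * Z ((k : ℤ) - 1) t ^ 2 -
          b ^ ((5 : ℝ) * (k : ℝ) / 2) * (Z k t * Z ((k : ℤ) + 1) t)) -
        ν * b ^ ((2 : ℝ) * (k : ℝ)) * Z k t) (Icc 0 s) t)
    (hnn : ∀ t ∈ Icc 0 s, ∀ k : ℕ, 1 ≤ k → 0 ≤ Z k t)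
    {k : ℕ} (hk : 1 ≤ k) {t : ℝ} (ht : t ∈ Icc 0 s) (hmax : IsMaxOn (Z k) (Icc 0 s) t) :
    b ^ ((5 : ℝ) / 2) * (Z k t * Z ((k : ℤ) + 1) t) ≤ Z ((k : ℤ) - 1) t ^ 2 := by
  have hpk := peak_ineq hb hc₀.le hdat hode hk ht hmax
  set B : ℝ := b ^ ((5 : ℝ) * ((k : ℝ) - 1) / 2) with hB
  have hBpos : 0 < B := Real.rpow_pos_of_pos hb _
  have hsplit : b ^ ((5 : ℝ) * (k : ℝ) / 2) = B * b ^ ((5 : ℝ) / 2) := by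
    rw [hB, ← Real.rpow_add hb]; congr 1; ring
  have hZk : 0 ≤ Z k t := hnn t ht k hk
  have hdiss : 0 ≤ ν * b ^ ((2 : ℝ) * (k : ℝ)) * Z k t := by positivity
  have h1 : c₀ * (B * b ^ ((5 : ℝ) / 2)) * (Z k t * Z ((k : ℤ) + 1) t) ≤ c₀ * B * Z ((k : ℤ) - 1) t ^ 2 := by
    rw [← hsplit]; linarith
  have h2 : (c₀ * B) * (b ^ ((5 : ℝ) / 2) * (Z k t * Z ((k : ℤ) + 1) t)) ≤ (c₀ * B) * Z ((k : ℤ) - 1) t ^ 2 := by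
    have e : c₀ * (B * b ^ ((5 : ℝ) / 2)) * (Z k t * Z ((k : ℤ) + 1) t) =
        (c₀ * B) * (b ^ ((5 : ℝ) / 2) * (Z k t * Z ((k : ℤ) + 1) t)) := by ring
    rw [e] at h1; exact h1
  exact le_of_mul_le_mul_left h2 (by positivity)

/-- **Weighted peak product inequality** (every exponent `θ`).  With `V_k = (b^θ)^k Z_k`, at a peak time `t⋆` of the shell
`k ≥ 1`: `V_k(t⋆) V_{k+1}(t⋆) ≤ b^{3θ-5/2} V_{k-1}(t⋆)²` — the three weights differ from `b^{5/2}` by `(b^θ)^3 = b^{3θ}`.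
[this file] -/
theorem weighted_peak_product_le {b c₀ ν s x₀ : ℝ} (θ : ℝ) (hb : 0 < b) (hc₀ : 0 < c₀) (hν : 0 ≤ ν)
    {Z : ℤ → ℝ → ℝ}
    (hdat : ∀ k : ℤ, Z k 0 = if k = 0 then x₀ else 0)
    (hode : ∀ k : ℕ, ∀ t ∈ Icc 0 s, HasDerivWithinAt (Z k)
      (c₀ * (b ^ ((5 : ℝ) * ((k : ℝ) - 1) / 2) * Z ((k : ℤ) - 1) t ^ 2 -
          b ^ ((5 : ℝ) * (k : ℝ) / 2) * (Z k t * Z ((k : ℤ) + 1) t)) -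
        ν * b ^ ((2 : ℝ) * (k : ℝ)) * Z k t) (Icc 0 s) t)
    (hnn : ∀ t ∈ Icc 0 s, ∀ k : ℕ, 1 ≤ k → 0 ≤ Z k t)
    {k : ℕ} (hk : 1 ≤ k) {t : ℝ} (ht : t ∈ Icc 0 s) (hmax : IsMaxOn (Z k) (Icc 0 s) t) :
    (b ^ θ) ^ k * Z k t * ((b ^ θ) ^ (k + 1) * Z ((k : ℤ) + 1) t) ≤
      b ^ (3 * θ - (5 : ℝ) / 2) * ((b ^ θ) ^ (k - 1) * Z ((k : ℤ) - 1) t) ^ 2 := by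
  have hP := peak_product_le hb hc₀ hν hdat hode hnn hk ht hmax
  have hW : 0 < b ^ θ := Real.rpow_pos_of_pos hb θ
  obtain ⟨m, rfl⟩ : ∃ m, k = m + 1 := ⟨k - 1, by omega⟩
  have hkm : m + 1 - 1 = m := by omega
  rw [hkm]
  -- `(b^θ)^3 = b^{3θ} = b^{3θ - 5/2} · b^{5/2}`
  have h3 : (b ^ θ) ^ 3 = b ^ (3 * θ - (5 : ℝ) / 2) * b ^ ((5 : ℝ) / 2) := by
    rw [← Real.rpow_add hb, ← Real.rpow_natCast, ← Real.rpow_mul hb.le]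
    congr 1; push_cast; ring
  have hfac : 0 ≤ b ^ (3 * θ - (5 : ℝ) / 2) * ((b ^ θ) ^ m) ^ 2 := by positivity
  have hmul := mul_le_mul_of_nonneg_left hP hfac
  have e1 : (b ^ θ) ^ (m + 1) * Z ((m + 1 : ℕ) : ℤ) t * ((b ^ θ) ^ (m + 1 + 1) * Z (((m + 1 : ℕ) : ℤ) + 1) t) =
      ((b ^ θ) ^ m) ^ 2 * (b ^ θ) ^ 3 * (Z ((m + 1 : ℕ) : ℤ) t * Z (((m + 1 : ℕ) : ℤ) + 1) t) := by ring
  calc (b ^ θ) ^ (m + 1) * Z ((m + 1 : ℕ) : ℤ) t * ((b ^ θ) ^ (m + 1 + 1) * Z (((m + 1 : ℕ) : ℤ) + 1) t)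
      = b ^ (3 * θ - (5 : ℝ) / 2) * ((b ^ θ) ^ m) ^ 2 *
          (b ^ ((5 : ℝ) / 2) * (Z ((m + 1 : ℕ) : ℤ) t * Z (((m + 1 : ℕ) : ℤ) + 1) t)) := by
        rw [e1, h3]; ring
    _ ≤ b ^ (3 * θ - (5 : ℝ) / 2) * ((b ^ θ) ^ m) ^ 2 * Z (((m + 1 : ℕ) : ℤ) - 1) t ^ 2 := hmul
    _ = b ^ (3 * θ - (5 : ℝ) / 2) * ((b ^ θ) ^ m * Z (((m + 1 : ℕ) : ℤ) - 1) t) ^ 2 := by ring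

/-- At the Kolmogorov exponent `θ = 5/6` the weighted peak product inequality has factor ONE:
`V_k(t⋆) V_{k+1}(t⋆) ≤ V_{k-1}(t⋆)²` (`V_k = (b^{5/6})^k Z_k`; in this currency constants are equilibria of the
inviscid chain at every ratio `b`). [this file] -/
theorem weighted_peak_product_le_kolmogorov {b c₀ ν s x₀ : ℝ} (hb : 0 < b) (hc₀ : 0 < c₀) (hν : 0 ≤ ν)
    {Z : ℤ → ℝ → ℝ}
    (hdat : ∀ k : ℤ, Z k 0 = if k = 0 then x₀ else 0)
    (hode : ∀ k : ℕ, ∀ t ∈ Icc 0 s, HasDerivWithinAt (Z k)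
      (c₀ * (b ^ ((5 : ℝ) * ((k : ℝ) - 1) / 2) * Z ((k : ℤ) - 1) t ^ 2 -
          b ^ ((5 : ℝ) * (k : ℝ) / 2) * (Z k t * Z ((k : ℤ) + 1) t)) -
        ν * b ^ ((2 : ℝ) * (k : ℝ)) * Z k t) (Icc 0 s) t)
    (hnn : ∀ t ∈ Icc 0 s, ∀ k : ℕ, 1 ≤ k → 0 ≤ Z k t)
    {k : ℕ} (hk : 1 ≤ k) {t : ℝ} (ht : t ∈ Icc 0 s) (hmax : IsMaxOn (Z k) (Icc 0 s) t) :
    (b ^ ((5 : ℝ) / 6)) ^ k * Z k t * ((b ^ ((5 : ℝ) / 6)) ^ (k + 1) * Z ((k : ℤ) + 1) t) ≤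
      ((b ^ ((5 : ℝ) / 6)) ^ (k - 1) * Z ((k : ℤ) - 1) t) ^ 2 := by
  have h := weighted_peak_product_le ((5 : ℝ) / 6) hb hc₀ hν hdat hode hnn hk ht hmax
  have h1 : b ^ (3 * ((5 : ℝ) / 6) - (5 : ℝ) / 2) = 1 := by
    rw [show 3 * ((5 : ℝ) / 6) - (5 : ℝ) / 2 = 0 by ring, Real.rpow_zero]
  simpa [h1] using h

/-- For `θ ≤ 5/6` and `b ≥ 1` the factor of the weighted peak product inequality is at most one. [this file] -/
theorem weight_factor_le_one {b θ : ℝ} (hb : 1 ≤ b) (hθ : θ ≤ 5 / 6) :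
    b ^ (3 * θ - (5 : ℝ) / 2) ≤ 1 :=
  Real.rpow_le_one_of_one_le_of_nonpos hb (by linarith)

/-- **THE FRONT DICHOTOMY.**  For every `b > 0`, exponent `θ`, constant `D ≥ 1`, `c₀ > 0`, `ν ≥ 0` and every honest
non-negative solution of the viscous chain from the one-shell datum on `[0,s]`: EITHER the `(θ, D)` barrier
`((b^θ)^k Z_k(t))² ≤ D x₀²` holds for all shells `k` and all `t ∈ [0,s]`, OR there are a first offending shell `k ≥ 1` and a
peak time `t⋆ ∈ (0,s]` of `Z_k` on `[0,s]` with: the barrier violated at `(k, t⋆)` and satisfied by every shell `j < k` on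
all of `[0,s]`; the peak inequality at `t⋆`; and the FRONT CONFIGURATION at `t⋆` — the weighted forward neighbour is below
the weighted backward neighbour by the factor `b^{3θ-5/2}`, which in turn is strictly below the weighted peak shell:
`(b^θ)^{k+1} Z_{k+1}(t⋆) ≤ b^{3θ-5/2} (b^θ)^{k-1} |Z_{k-1}(t⋆)|` and `(b^θ)^{k-1} |Z_{k-1}(t⋆)| < (b^θ)^k Z_k(t⋆)`.
[this file] -/
theorem barrier_or_firstOvershoot {b c₀ ν s x₀ θ D : ℝ} (hb : 0 < b) (hc₀ : 0 < c₀) (hν : 0 ≤ ν) (hs : 0 ≤ s)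
    (hD : 1 ≤ D) {Z : ℤ → ℝ → ℝ}
    (hdat : ∀ k : ℤ, Z k 0 = if k = 0 then x₀ else 0)
    (hvan : ∀ t, Z (-1) t = 0)
    (hcont : ∀ k : ℕ, ContinuousOn (Z k) (Icc 0 s))
    (hode : ∀ k : ℕ, ∀ t ∈ Icc 0 s, HasDerivWithinAt (Z k)
      (c₀ * (b ^ ((5 : ℝ) * ((k : ℝ) - 1) / 2) * Z ((k : ℤ) - 1) t ^ 2 -
          b ^ ((5 : ℝ) * (k : ℝ) / 2) * (Z k t * Z ((k : ℤ) + 1) t)) -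
        ν * b ^ ((2 : ℝ) * (k : ℝ)) * Z k t) (Icc 0 s) t)
    (hnn : ∀ t ∈ Icc 0 s, ∀ k : ℕ, 1 ≤ k → 0 ≤ Z k t) :
    (∀ k : ℕ, ∀ t ∈ Icc 0 s, ((b ^ θ) ^ k * Z k t) ^ 2 ≤ D * x₀ ^ 2) ∨
    (∃ k : ℕ, 1 ≤ k ∧ ∃ t ∈ Ioc 0 s, IsMaxOn (Z k) (Icc 0 s) t ∧
      D * x₀ ^ 2 < ((b ^ θ) ^ k * Z k t) ^ 2 ∧
      (∀ j : ℕ, j < k → ∀ τ ∈ Icc 0 s, ((b ^ θ) ^ j * Z j τ) ^ 2 ≤ D * x₀ ^ 2) ∧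
      c₀ * b ^ ((5 : ℝ) * (k : ℝ) / 2) * (Z k t * Z ((k : ℤ) + 1) t) + ν * b ^ ((2 : ℝ) * (k : ℝ)) * Z k t ≤
        c₀ * b ^ ((5 : ℝ) * ((k : ℝ) - 1) / 2) * Z ((k : ℤ) - 1) t ^ 2 ∧
      (b ^ θ) ^ (k + 1) * Z ((k : ℤ) + 1) t ≤ b ^ (3 * θ - (5 : ℝ) / 2) * ((b ^ θ) ^ (k - 1) * |Z ((k : ℤ) - 1) t|) ∧
      (b ^ θ) ^ (k - 1) * |Z ((k : ℤ) - 1) t| < (b ^ θ) ^ k * Z k t) := by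
  classical
  by_cases hall : ∀ k : ℕ, ∀ t ∈ Icc 0 s, ((b ^ θ) ^ k * Z k t) ^ 2 ≤ D * x₀ ^ 2
  · exact Or.inl hall
  right
  have hW : 0 < b ^ θ := Real.rpow_pos_of_pos hb θ
  have hx0 : 0 ≤ D * x₀ ^ 2 := by positivity
  -- the offending shells
  have hex : ∃ k : ℕ, ∃ t ∈ Icc (0 : ℝ) s, D * x₀ ^ 2 < ((b ^ θ) ^ k * Z k t) ^ 2 := by
    by_contra hne
    apply hall
    intro k t ht
    by_contra hlt
    exact hne ⟨k, t, ht, lt_of_not_ge hlt⟩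
  -- the first one
  let k := Nat.find hex
  have hPk : ∃ t ∈ Icc (0 : ℝ) s, D * x₀ ^ 2 < ((b ^ θ) ^ k * Z k t) ^ 2 := Nat.find_spec hex
  have hmin : ∀ j : ℕ, j < k → ∀ τ ∈ Icc 0 s, ((b ^ θ) ^ j * Z j τ) ^ 2 ≤ D * x₀ ^ 2 := by
    intro j hj τ hτ
    have hnot := Nat.find_min hex hj
    by_contra hlt
    exact hnot ⟨τ, hτ, lt_of_not_ge hlt⟩
  -- the datum shell never offends (`Z_0² ≤ x₀² ≤ D x₀²`), so `k ≥ 1`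
  have hk1 : 1 ≤ k := by
    by_contra hk0
    have hk0' : k = 0 := by omega
    obtain ⟨τ, hτ, hlt⟩ := hPk
    rw [hk0'] at hlt
    have hd := datum_sq_le hc₀.le hν hdat hvan hcont hode hnn τ hτ
    have : ((b ^ θ) ^ 0 * Z ((0 : ℕ) : ℤ) τ) ^ 2 ≤ D * x₀ ^ 2 := by
      have hx : x₀ ^ 2 ≤ D * x₀ ^ 2 := by nlinarith [sq_nonneg x₀]
      simpa using hd.trans hx
    exact absurd hlt (not_lt.mpr this)
  -- a peak time of the offending shell; the offence persists there
  obtain ⟨t, ht, hmax⟩ := exists_peak hs hcont k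
  obtain ⟨τ, hτ, hlt⟩ := hPk
  have hZτ : 0 ≤ Z k τ := hnn τ hτ k hk1
  have hZt : 0 ≤ Z k t := hnn t ht k hk1
  have hle : Z k τ ≤ Z k t := hmax hτ
  have hVt : D * x₀ ^ 2 < ((b ^ θ) ^ k * Z k t) ^ 2 := by
    have h1 : (b ^ θ) ^ k * Z k τ ≤ (b ^ θ) ^ k * Z k t := mul_le_mul_of_nonneg_left hle (pow_nonneg hW.le _)
    have h0 : 0 ≤ (b ^ θ) ^ k * Z k τ := mul_nonneg (pow_nonneg hW.le _) hZτ
    exact hlt.trans_le (pow_le_pow_left₀ h0 h1 2)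
  -- the peak is not at time `0` (the shell `k ≥ 1` vanishes there)
  have ht0 : 0 < t := by
    rcases ht.1.eq_or_lt with h0 | h0
    · exfalso
      have hz : Z k t = 0 := by
        rw [← h0, hdat]
        have hkne : k ≠ 0 := by omega
        simp [hkne]
      rw [hz] at hVt
      simp at hVt
      exact absurd hVt (not_lt.mpr hx0)
    · exact h0
  refine ⟨k, hk1, t, ⟨ht0, ht.2⟩, hmax, hVt, hmin, peak_ineq hb hc₀.le hdat hode hk1 ht hmax, ?_⟩
  -- the front configuration
  set A : ℝ := (b ^ θ) ^ (k - 1) * |Z ((k : ℤ) - 1) t| with hA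
  set B : ℝ := (b ^ θ) ^ k * Z k t with hB
  set C : ℝ := (b ^ θ) ^ (k + 1) * Z ((k : ℤ) + 1) t with hC
  have hA0 : 0 ≤ A := by positivity
  have hB0 : 0 ≤ B := mul_nonneg (pow_nonneg hW.le _) hZt
  -- `A² ≤ D x₀² < B²`, hence `A < B` and `B > 0`
  have hA2 : A ^ 2 ≤ D * x₀ ^ 2 := by
    have h := hmin (k - 1) (by omega) t ht
    have hcast : (((k - 1 : ℕ) : ℤ)) = (k : ℤ) - 1 := by
      have : 1 ≤ k := hk1
      push_cast [Nat.cast_sub this]; ring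
    rw [hcast] at h
    rw [hA, mul_pow, sq_abs, ← mul_pow]
    exact h
  have hAB : A < B := lt_of_pow_lt_pow_left₀ 2 hB0 (hA2.trans_lt hVt)
  have hBpos : 0 < B := lt_of_le_of_lt hA0 hAB
  -- weighted peak product: `B·C ≤ β A²`, and `A² ≤ A·B`
  have hprod := weighted_peak_product_le θ hb hc₀ hν hdat hode hnn hk1 ht hmax
  have hβ : 0 < b ^ (3 * θ - (5 : ℝ) / 2) := Real.rpow_pos_of_pos hb _
  have hsq : ((b ^ θ) ^ (k - 1) * Z ((k : ℤ) - 1) t) ^ 2 = A ^ 2 := by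
    rw [hA, mul_pow, mul_pow, sq_abs]
  have hBC : B * C ≤ b ^ (3 * θ - (5 : ℝ) / 2) * A ^ 2 := by
    rw [hB, hC, ← hsq]; exact hprod
  have hA2le : A ^ 2 ≤ A * B := by nlinarith
  have hBC' : B * C ≤ B * (b ^ (3 * θ - (5 : ℝ) / 2) * A) := by
    calc B * C ≤ b ^ (3 * θ - (5 : ℝ) / 2) * A ^ 2 := hBC
      _ ≤ b ^ (3 * θ - (5 : ℝ) / 2) * (A * B) := mul_le_mul_of_nonneg_left hA2le hβ.le
      _ = B * (b ^ (3 * θ - (5 : ℝ) / 2) * A) := by ring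
  exact ⟨le_of_mul_le_mul_left hBC' hBpos, hAB⟩

/-- **No front overshoot ⇒ barrier** (contrapositive packaging of `barrier_or_firstOvershoot`).  If no shell `k ≥ 1` has a
peak time `t⋆ ∈ (0,s]` at which the `(θ, D)` barrier is violated while the weighted forward neighbour lies below
`b^{3θ-5/2}` times the weighted backward neighbour, which lies strictly below the weighted peak, then the `(θ, D)` barrier
holds on `[0,s]` for every shell.  For `θ = 5/6`, `D = 1` this is the analytic small-ratio target in front currency.
[this file] -/
theorem barrier_of_noFrontOvershoot {b c₀ ν s x₀ θ D : ℝ} (hb : 0 < b) (hc₀ : 0 < c₀) (hν : 0 ≤ ν) (hs : 0 ≤ s)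
    (hD : 1 ≤ D) {Z : ℤ → ℝ → ℝ}
    (hdat : ∀ k : ℤ, Z k 0 = if k = 0 then x₀ else 0)
    (hvan : ∀ t, Z (-1) t = 0)
    (hcont : ∀ k : ℕ, ContinuousOn (Z k) (Icc 0 s))
    (hode : ∀ k : ℕ, ∀ t ∈ Icc 0 s, HasDerivWithinAt (Z k)
      (c₀ * (b ^ ((5 : ℝ) * ((k : ℝ) - 1) / 2) * Z ((k : ℤ) - 1) t ^ 2 -
          b ^ ((5 : ℝ) * (k : ℝ) / 2) * (Z k t * Z ((k : ℤ) + 1) t)) -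
        ν * b ^ ((2 : ℝ) * (k : ℝ)) * Z k t) (Icc 0 s) t)
    (hnn : ∀ t ∈ Icc 0 s, ∀ k : ℕ, 1 ≤ k → 0 ≤ Z k t)
    (hfront : ∀ k : ℕ, 1 ≤ k → ∀ t ∈ Ioc 0 s, IsMaxOn (Z k) (Icc 0 s) t →
      D * x₀ ^ 2 < ((b ^ θ) ^ k * Z k t) ^ 2 →
      (b ^ θ) ^ (k + 1) * Z ((k : ℤ) + 1) t ≤ b ^ (3 * θ - (5 : ℝ) / 2) * ((b ^ θ) ^ (k - 1) * |Z ((k : ℤ) - 1) t|) →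
      (b ^ θ) ^ (k - 1) * |Z ((k : ℤ) - 1) t| < (b ^ θ) ^ k * Z k t → False) :
    ∀ k : ℕ, ∀ t ∈ Icc 0 s, ((b ^ θ) ^ k * Z k t) ^ 2 ≤ D * x₀ ^ 2 := by
  rcases barrier_or_firstOvershoot (θ := θ) hb hc₀ hν hs hD hdat hvan hcont hode hnn with h | h
  · exact h
  · obtain ⟨k, hk, t, ht, hmax, hV, _hmin, _hpk, hfwd, hbwd⟩ := h
    exact (hfront k hk t ht hmax hV hfwd hbwd).elim

end Summit.NavierStokesRegularity.NavierStokesRegularity.Theorems.KPChainFront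

end
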